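import Summits.BirchSwinnertonDyer.BirchSwinnertonDyer.Theorems.ByReductionTypeAtTwoRankOneAtTwoBigImageOddLocalOneDoorBottomLeavesLines
import HarnessLib

/-!
# Route `GenusKolyvaginAtTwo`, residual `OffCutResidualAtTwoR` (stmt-BirchSwinnertonDyer-31767), LINE 27 «socle_selection» STUB S2, conjunct (RTV):
# on a `Δ > 0` curve whose `2`-Selmer group has four elements there IS a non-zero REAL-TRIVIAL Selmer class

LEAD seat `bsd-line-gk2-p1` g24 (cell `bsd-f1-sign2`), `--supports stmt-BirchSwinnertonDyer-31767 --as helper`.  THEOREMS ONLY (no definition, no named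
fact, no `sorry`).  **BSD is NOT proved by this file; `OffCutResidualAtTwoR` is NOT proved; S2 is NOT closed (its (HL) and (SOC) conjuncts remain).**

WHAT.  LINE 27's stub S2 `stub_shallowFrameSocle` (v1.8) is the conjunction (HL) ∧ (SOC) ∧ (RTV); this file proves **(RTV) verbatim in shape**:
`∃ v ∈ W.selmerGroup 2, v ≠ 0 ∧ ∀ w : InfinitePlace ℚ, v ∈ W.torsionLocalKer w.Completion 2`, from `0 < W.Δ` and `Nat.card (W.selmerGroup 2) = 4` ALONE
(no frame, no twin, no print).  Mechanism: for `Δ > 0` the archimedean Kummer condition `𝓛_∞ ⊂ H¹(ℝ, E[2])` has TWO elements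
(`GenusKolyArch.natCard_kummerSelmerStructure_inl_rat_eq_two_of_Δ_pos`), so any two Selmer classes with non-zero real localisation differ by a
REAL-TRIVIAL class (fkl's one-line leaf `RankOneAtTwoOneDoor.sub_mem_torsionLocalKer_inf_of_card_eq_two`); among the three non-zero classes of
`Sel₂(E) ≅ (ℤ/2)²` either one is real-trivial already or two real-nontrivial ones differ by a non-zero real-trivial one.  So the pen may SPLIT S2 into
(HL) ∧ (SOC) and take (RTV) from `realTrivial_of_natCard_selmerGroup_two_eq_four`.  BSD is NOT proved by any of this.

References: [Kramer1981] §2 Prop. 6; [MazurRubin2010] Lemma 2.2, Lemma 3.2; [GrossLMS1991] Prop. 8.2.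
-/

set_option autoImplicit false
-- the Theorems namespace of this sub repeats the summit name by design (D-0017 nested layout)
set_option linter.dupNamespace false

noncomputable section

open scoped Classical

namespace Summit.BirchSwinnertonDyer.BirchSwinnertonDyer.Theorems.GenusExact.PlusDescent.SocleSelection

open WeierstrassCurve NumberField Literature.NumberTheory.EllipticCurves Literature.NumberTheory.GaloisRepresentations
open Summit.BirchSwinnertonDyer.BirchSwinnertonDyer.Theorems.RankOneAtTwoOneDoor
open Summit.BirchSwinnertonDyer.BirchSwinnertonDyer.Theorems.GenusKolyArch

/-- **(RTV) of LINE 27 S2: a non-zero REAL-TRIVIAL `2`-Selmer class exists** on every elliptic `W/ℚ` with `Δ_W > 0` and `#Sel₂(W) = 4`.  Shape = the (RTV)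
conjunct of `stub_shallowFrameSocle` verbatim (`W.selmerGroup 2`, `W.torsionLocalKer w.Completion 2`).  Two real-nontrivial Selmer classes differ by a
real-trivial one because `#𝓛_∞ = 2`; a four-element group has two distinct non-zero elements.  BSD is NOT proved by this.
[cite: Kramer1981, §2 Prop. 6] [cite: MazurRubin2010, Lemma 2.2] [cite: GrossLMS1991, Prop. 8.2] -/
theorem realTrivial_of_natCard_selmerGroup_two_eq_four (W : WeierstrassCurve ℚ) [W.IsElliptic] (hΔ : 0 < W.Δ)
    (h4 : Nat.card (W.selmerGroup 2) = 4) :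
    ∃ v ∈ W.selmerGroup 2, v ≠ 0 ∧ ∀ w : InfinitePlace ℚ, v ∈ W.torsionLocalKer w.Completion 2 := by
  -- work at `n = ((2 : ℕ) : ℤ)` (definitionally `2`)
  change ∃ v ∈ selmerGroup W ((2 : ℕ) : ℤ), v ≠ 0 ∧ ∀ w : InfinitePlace ℚ, v ∈ W.torsionLocalKer w.Completion ((2 : ℕ) : ℤ)
  have h4' : Nat.card (selmerGroup W ((2 : ℕ) : ℤ)) = 4 := h4
  set S : AddSubgroup (galH1Torsion W ((2 : ℕ) : ℤ)) := selmerGroup W ((2 : ℕ) : ℤ) with hS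
  -- the unique infinite place and `#𝓛_∞ = 2`
  set w₀ : InfinitePlace ℚ := Rat.infinitePlace with hw₀
  have hcard : Nat.card (W.kummerSelmerStructure ((2 : ℕ) : ℤ) (Sum.inl w₀)) = 2 :=
    natCard_kummerSelmerStructure_inl_rat_eq_two_of_Δ_pos W hΔ w₀
  -- Selmer classes satisfy the Kummer condition at `w₀`
  have hloc : ∀ {s : galH1Torsion W ((2 : ℕ) : ℤ)}, s ∈ S → s ∈ selmerLocalKer W w₀.Completion ((2 : ℕ) : ℤ) :=
    fun hs ↦ ((mem_selmerGroup_iff W _ _).mp hs).2 w₀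
  -- it suffices to produce a non-zero Selmer class in `torsionLocalKer` at `w₀`
  suffices h : ∃ v ∈ S, v ≠ 0 ∧ v ∈ W.torsionLocalKer w₀.Completion ((2 : ℕ) : ℤ) by
    obtain ⟨v, hv, hv0, hvt⟩ := h
    exact ⟨v, hv, hv0, fun w ↦ by rw [Subsingleton.elim w w₀]; exact hvt⟩
  by_contra hno
  push Not at hno
  -- two distinct non-zero Selmer classes
  haveI : Finite S := Nat.finite_of_card_ne_zero (by rw [h4']; norm_num)
  haveI : Fintype S := Fintype.ofFinite S
  have h3 : 2 < Fintype.card S := by rw [← Nat.card_eq_fintype_card, h4']; norm_num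
  obtain ⟨a, b, c, hab, hac, hbc⟩ := (Fintype.two_lt_card_iff).mp h3
  -- among three pairwise distinct elements two are non-zero
  obtain ⟨x, y, hx0, hy0, hxy⟩ : ∃ x y : S, x ≠ 0 ∧ y ≠ 0 ∧ x ≠ y := by
    by_cases ha : a = 0
    · refine ⟨b, c, ?_, ?_, hbc⟩
      · rintro rfl; exact hab ha
      · rintro rfl; exact hac ha
    · by_cases hb : b = 0
      · refine ⟨a, c, ha, ?_, hac⟩
        rintro rfl; exact hbc hb
      · exact ⟨a, b, ha, hb, hab⟩
  have hx0' : (x : galH1Torsion W ((2 : ℕ) : ℤ)) ≠ 0 := fun h ↦ hx0 (Subtype.ext h)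
  have hy0' : (y : galH1Torsion W ((2 : ℕ) : ℤ)) ≠ 0 := fun h ↦ hy0 (Subtype.ext h)
  -- both are real-NONtrivial (else done), so their difference is real-trivial, Selmer, and non-zero
  have hxt := hno x x.2 hx0'
  have hyt := hno y y.2 hy0'
  have hsub := sub_mem_torsionLocalKer_inf_of_card_eq_two W w₀ hcard (hloc x.2) (hloc y.2) hxt hyt
  have hmem : (x : galH1Torsion W ((2 : ℕ) : ℤ)) - y ∈ S := S.sub_mem x.2 y.2
  have hne : (x : galH1Torsion W ((2 : ℕ) : ℤ)) - y ≠ 0 := fun h ↦ hxy (Subtype.ext (sub_eq_zero.mp h))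
  exact hno _ hmem hne hsub

end Summit.BirchSwinnertonDyer.BirchSwinnertonDyer.Theorems.GenusExact.PlusDescent.SocleSelection

end
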